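import Summits.BirchSwinnertonDyer.BirchSwinnertonDyer.Theorems.UniversalToricDescentTwoSidedMuTransfer
import Literature.NumberTheory.EllipticCurves.IwasawaAlgebraLengthAwayComparisonProofs
import Literature.NumberTheory.EllipticCurves.IwasawaAlgebraCharIdealProofs
import HarnessLib

/-!
# Route UniversalToricDescent — the two-sided link in `μ`-currency, Howard's divisibility read in the
# tree's CHARACTERISTIC-IDEAL currency (`Ch(X_tors) ∣ I(ℋ_∞)²`), any prime `p`

Lead prover bsd-wall-utd-p1 g21 (`--supports stmt-BirchSwinnertonDyer-24737`, crux `TwinAlgMuZeroAtThree` R2);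
sequel of `…Theorems.UniversalToricDescentTwoSidedMuTransfer` (p730564). There the Kolyvagin input K2 was
taken as the `μ`-inequality `μ(X_tors) ≤ 2·μ(𝔖/Λκ)`. Howard's Theorem B — and its tree transcription
`Literature.NumberTheory.EllipticCurves.Howard2004_thmB`, and the bucket-B port `HowardDivisibilityMultThree`
of the crux-idea card `local-indivisibility-road` — conclude instead a divisibility of characteristic ideals
`Ch_Λ(X_{Λ-tors}) ∣ I(ℋ_∞)²` with `I(ℋ_∞) = Ch_Λ(𝔖/ℋ_∞)` (`heegnerCharIdeal D F`, Perrin-Riou's `I(H_∞)`),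
`ℋ_∞ ⊆ 𝔖` the Heegner module. This file supplies the dictionary (pure `Λ`-algebra, PROVED):

* §1 `muInvariant_le_mul_of_charIdeal_dvd_pow` — for finitely generated torsion `Λ`-modules `T`, `Q`:
  `Ch(T) ∣ Ch(Q)^n ⟹ μ(T) ≤ n·μ(Q)` (`μ` = multiplicity of the prime element `p` in a generator of `Ch`,
  tree `Module.lengthAt_eq_emultiplicity_of_charIdeal_eq_span`; `Λ = ℤ_p⟦T⟧` is a Noetherian UFD).
* §2 `muInvariant_quotient_le_of_mem` — `κ ∈ ℋ ≤ 𝔖`, `𝔖/Λκ` finitely generated torsion ⟹ `μ(𝔖/ℋ) ≤ μ(𝔖/Λκ)`.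
* §3 `isTorsion_and_exists_generator_twoSided_of_charIdeal_dvd_sq` — the assembly of the two-sided link with
  K2 in the currency `Ch(X_tors) ∣ Ch(𝔖/ℋ)²` for ANY submodule `ℋ ∋ κ` (e.g. `ℋ = heegnerModule D F`,
  `𝔖 = D.S`, so that the hypothesis is VERBATIM the last conjunct of `Howard2004_thmB` /
  `HowardDivisibilityMultThree`) and K1 `loc κ ∉ p·U`: `X_{∅,0}` is `Λ`-torsion with
  `Ch_Λ(X_{∅,0})·R₀⟦T⟧ = (g)`, `g` with a norm-one coefficient — the conclusion shape of `TwinAlgMuZeroAtThree`.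

THEOREMS ONLY (no definition, no named fact, no `sorry`); no `Theses` import. BSD is not advanced by this file;
stmt-24737 stays open (its ARITHMETIC inputs — the global-duality sequences, K1, K2 at `3 ∥ N′` — are not here).

References: [Howard2004HeegnerKolyvagin] Thm. B (`char(X_tors) = ch(M)²`, `ch(M) ∣ 𝐋 = char(H¹_{F_Λ}(K,𝐓)/𝐇)`);
[Castella2017HeegnerBeilinsonFlach] App. A, Lemmas A.3–A.4, Thm. A.5 (arXiv:1509.02761 pp. 19–20);
[PerrinRiou1987BSMF] §1 p. 405 (`I(H_∞)`); [Washington1997] §13.2; [NeukirchSchmidtWingberg2008] V §3 (5.3.9)–(5.3.10).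
-/

noncomputable section
open scoped Classical

-- `…BirchSwinnertonDyer.BirchSwinnertonDyer.Theorems…` is the problem's mandated namespace (D-0017).
set_option linter.dupNamespace false
set_option autoImplicit false

namespace Summit.BirchSwinnertonDyer.BirchSwinnertonDyer.Theorems.UniversalToricDescentTwoSidedMuTransfer

open Literature.NumberTheory.EllipticCurves Literature.NumberTheory.EllipticCurves.IwasawaAlgebra
  Literature.NumberTheory.EllipticCurves.Module
  Summit.BirchSwinnertonDyer.BirchSwinnertonDyer.Theorems.UniversalToricDescentAcDualMuZero

variable {p : ℕ} [Fact p.Prime]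

/-! ### §1 `Ch(T) ∣ Ch(Q)^n ⟹ μ(T) ≤ n·μ(Q)` -/

/-- `μ(M)` is the `p`-adic multiplicity of any generator of `Ch_Λ(M)` (`M` finitely generated torsion):
`Ch(M) = (f)` ⟹ `μ(M) = emultiplicity p f`, as natural numbers. [cite: Washington1997, §13.2]
[cite: NeukirchSchmidtWingberg2008, Ch. V §3, (5.3.9)–(5.3.10)] -/
theorem muInvariant_eq_emultiplicity_toNat {M : Type*} [AddCommGroup M] [Module (IwasawaAlgebra p) M]
    [Module.Finite (IwasawaAlgebra p) M] (hM : Module.IsTorsion (IwasawaAlgebra p) M)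
    {f : IwasawaAlgebra p} (hf : Module.charIdeal (IwasawaAlgebra p) M = Ideal.span {f}) :
    muInvariant p M = (emultiplicity (PowerSeries.C (p : ℤ_[p]) : IwasawaAlgebra p) f).toNat := by
  have h := lengthAt_eq_emultiplicity_of_charIdeal_eq_span hM (prime_C p) hf
  rw [muInvariant_eq_toNat_lengthAt p M
    ⟨Ideal.span {PowerSeries.C (p : ℤ_[p])}, (Ideal.span_singleton_prime (prime_C p).ne_zero).mpr
      (prime_C p)⟩ rfl, h]

/-- **`Ch(T) ∣ Ch(Q)^n ⟹ μ(T) ≤ n·μ(Q)`** for finitely generated torsion `Λ`-modules `T`, `Q`: both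
characteristic ideals are principal (tree `charIdeal_isPrincipal_holds`), `(f) ∣ (g)^n` gives `f ∣ g^n`, and
`μ` is the `p`-adic multiplicity of a generator (`emultiplicity` is monotone under divisibility and
`emultiplicity p (g^n) = n · emultiplicity p g`). The dictionary between Howard's divisibility
`Ch(X_tors) ∣ I(ℋ_∞)²` and the `μ`-inequality consumed by `muInvariant_le_two_mul_of_howard`.
[cite: Howard2004HeegnerKolyvagin, Thm. B] [cite: Washington1997, §13.2] -/
theorem muInvariant_le_mul_of_charIdeal_dvd_pow {T Q : Type*} [AddCommGroup T] [Module (IwasawaAlgebra p) T]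
    [AddCommGroup Q] [Module (IwasawaAlgebra p) Q] [Module.Finite (IwasawaAlgebra p) T]
    [Module.Finite (IwasawaAlgebra p) Q] (hT : Module.IsTorsion (IwasawaAlgebra p) T)
    (hQ : Module.IsTorsion (IwasawaAlgebra p) Q) (n : ℕ)
    (h : Module.charIdeal (IwasawaAlgebra p) T ∣ Module.charIdeal (IwasawaAlgebra p) Q ^ n) :
    muInvariant p T ≤ n * muInvariant p Q := by
  obtain ⟨f, hf⟩ := (charIdeal_isPrincipal_holds p T).principal
  obtain ⟨g, hg⟩ := (charIdeal_isPrincipal_holds p Q).principal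
  have hf' : Module.charIdeal (IwasawaAlgebra p) T = Ideal.span {f} := hf
  have hg' : Module.charIdeal (IwasawaAlgebra p) Q = Ideal.span {g} := hg
  rw [hf', hg', Ideal.span_singleton_pow] at h
  have hdvd : f ∣ g ^ n := Ideal.span_singleton_le_span_singleton.mp (Ideal.le_of_dvd h)
  have hmul := emultiplicity_le_emultiplicity_of_dvd_right
    (a := (PowerSeries.C (p : ℤ_[p]) : IwasawaAlgebra p)) hdvd
  rw [emultiplicity_pow (prime_C p)] at hmul
  -- finiteness of the multiplicity of `p` in `g` (`Q` torsion ⟹ `g ≠ 0`)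
  have hQfin : emultiplicity (PowerSeries.C (p : ℤ_[p]) : IwasawaAlgebra p) g ≠ ⊤ := by
    have hlen := lengthAt_ne_top_of_isTorsion p Q hQ
      ⟨Ideal.span {PowerSeries.C (p : ℤ_[p])},
        (Ideal.span_singleton_prime (prime_C p).ne_zero).mpr (prime_C p)⟩ rfl
    rwa [lengthAt_eq_emultiplicity_of_charIdeal_eq_span hQ (prime_C p) hg'] at hlen
  rw [muInvariant_eq_emultiplicity_toNat hT hf', muInvariant_eq_emultiplicity_toNat hQ hg']
  have hnfin : (n : ℕ∞) * emultiplicity (PowerSeries.C (p : ℤ_[p]) : IwasawaAlgebra p) g ≠ ⊤ :=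
    WithTop.mul_ne_top (ENat.coe_ne_top n) hQfin
  have := ENat.toNat_le_toNat hmul hnfin
  rwa [ENat.toNat_mul, ENat.toNat_coe] at this

/-! ### §2 `κ ∈ ℋ ⟹ μ(𝔖/ℋ) ≤ μ(𝔖/Λκ)` -/

/-- **`κ ∈ ℋ ≤ 𝔖` ⟹ `μ(𝔖/ℋ) ≤ μ(𝔖/Λκ)`** when `𝔖` is finitely generated and `𝔖/Λκ` is torsion: `𝔖/Λκ ↠ 𝔖/ℋ`
and `μ` does not increase along surjections (tree `muInvariant_le_of_surjective`). On the `(β)`-road the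
`Λ`-adic Heegner class `κ_∞` lies in the Heegner module `ℋ_∞`, so Howard's `I(ℋ_∞)` is dominated by `Ch(𝔖/Λκ_∞)`
in `μ`. [cite: PerrinRiou1987BSMF, §1 p. 405] [cite: GreenbergLNM1716, §5] -/
theorem muInvariant_quotient_le_of_mem {S : Type*} [AddCommGroup S] [Module (IwasawaAlgebra p) S]
    [Module.Finite (IwasawaAlgebra p) S] (H : Submodule (IwasawaAlgebra p) S) {κ : S} (hκ : κ ∈ H)
    (hS1 : Module.IsTorsion (IwasawaAlgebra p) (S ⧸ Submodule.span (IwasawaAlgebra p) {κ})) :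
    muInvariant p (S ⧸ H) ≤ muInvariant p (S ⧸ Submodule.span (IwasawaAlgebra p) {κ}) := by
  have hle : Submodule.span (IwasawaAlgebra p) {κ} ≤ H.comap LinearMap.id := by
    rw [Submodule.comap_id, Submodule.span_singleton_le_iff_mem]; exact hκ
  refine muInvariant_le_of_surjective hS1 (Submodule.mapQ _ _ LinearMap.id hle) fun y => ?_
  induction y using Submodule.Quotient.induction_on with
  | H s => exact ⟨Submodule.Quotient.mk s, by rw [Submodule.mapQ_apply, LinearMap.id_apply]⟩

/-! ### §3 Assembly with K2 in characteristic-ideal currency -/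

section Assembly

variable {C X₁ X X₀ X₃ S U : Type*}
  [AddCommGroup C] [Module (IwasawaAlgebra p) C]
  [AddCommGroup X₁] [Module (IwasawaAlgebra p) X₁] [AddCommGroup X] [Module (IwasawaAlgebra p) X]
  [AddCommGroup X₀] [Module (IwasawaAlgebra p) X₀] [AddCommGroup X₃] [Module (IwasawaAlgebra p) X₃]
  [AddCommGroup S] [Module (IwasawaAlgebra p) S] [AddCommGroup U] [Module (IwasawaAlgebra p) U]
  [Module.Finite (IwasawaAlgebra p) X₁] [Module.Finite (IwasawaAlgebra p) X₀]
  [Module.Finite (IwasawaAlgebra p) X] [Module.Finite (IwasawaAlgebra p) S]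
  {f₁ : C →ₗ[IwasawaAlgebra p] X₁} {g₁ : X₁ →ₗ[IwasawaAlgebra p] X}
  (hf₁ : Function.Injective f₁) (hg₁ : Function.Surjective g₁) (h₁ : Function.Exact f₁ g₁)
  {f₀ : C →ₗ[IwasawaAlgebra p] X₀} {g₀ : X₀ →ₗ[IwasawaAlgebra p] X₃}
  (hf₀ : Function.Injective f₀) (hg₀ : Function.Surjective g₀) (h₀ : Function.Exact f₀ g₀)
  (hC : Module.IsTorsion (IwasawaAlgebra p) C) (hX₃ : Module.IsTorsion (IwasawaAlgebra p) X₃)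
  (hdual : muInvariant p X₃ ≤ muInvariant p (Submodule.torsion (IwasawaAlgebra p) X₁))

include hf₁ hg₁ h₁ hf₀ hg₀ h₀ hC hX₃ hdual

/-- **Two-sided link + Howard's `Ch(X_tors) ∣ Ch(𝔖/ℋ)²` + `(β)` ⟹ the conclusion of `TwinAlgMuZeroAtThree` at
`X₀ = X_{∅,0}`.** Data: the global-duality sequences (A.5) `0 → C → X₁ → X → 0`, (A.7) `0 → C → X₀ → X₃ → 0`
with `C`, `X₃` torsion and the duality/conjugation input `μ(X₃) ≤ μ((X₁)_tors)`; the finitely generated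
torsion-free rank-one `𝔖` with class `κ` (`𝔖/Λκ` torsion) lying in a submodule `ℋ` (the Heegner module);
`loc : 𝔖 → U ≅ Λ` with `C ≅ U/loc(𝔖)`; K2 VERBATIM in Howard's currency
`Ch_Λ(X_{Λ-tors}) ∣ Ch_Λ(𝔖/ℋ)²` (= `… ∣ heegnerCharIdeal D F ^ 2` for `𝔖 = D.S`, `ℋ = heegnerModule D F`);
K1 `loc κ ∉ p·U`. Conclusion: `X₀` is `Λ`-torsion and `Ch_Λ(X₀)·R₀⟦T⟧ = (g)` with a norm-one coefficient of `g`.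
[cite: Howard2004HeegnerKolyvagin, Thm. B] [cite: Castella2017HeegnerBeilinsonFlach, App. A, Lemmas A.2–A.4, Thm. A.5]
[cite: BurungaleCastellaKim2021, Thm. 4.1] [cite: GreenbergVatsal2000, p. 2, (1)–(2)] -/
theorem isTorsion_and_exists_generator_twoSided_of_charIdeal_dvd_sq
    [NoZeroSMulDivisors (IwasawaAlgebra p) S]
    (κ : S) (hS1 : Module.IsTorsion (IwasawaAlgebra p) (S ⧸ Submodule.span (IwasawaAlgebra p) {κ}))
    (H : Submodule (IwasawaAlgebra p) S) (hκH : κ ∈ H)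
    (loc : S →ₗ[IwasawaAlgebra p] U) (eU : U ≃ₗ[IwasawaAlgebra p] IwasawaAlgebra p)
    (eC : C ≃ₗ[IwasawaAlgebra p] (U ⧸ LinearMap.range loc))
    (hHoward : Module.charIdeal (IwasawaAlgebra p) (Submodule.torsion (IwasawaAlgebra p) X) ∣
      Module.charIdeal (IwasawaAlgebra p) (S ⧸ H) ^ 2)
    (hβ : ¬ ∃ v : U, loc κ = (p : IwasawaAlgebra p) • v) :
    Module.IsTorsion (IwasawaAlgebra p) X₀ ∧
      ∃ g : UnrSeries p,
        (Module.charIdeal (IwasawaAlgebra p) X₀).map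
            (PowerSeries.map (Summit.BirchSwinnertonDyer.Rank1Residual.X11b.Halves.toUnr p)) =
          Ideal.span {g} ∧
          ∃ i : ℕ, ‖((PowerSeries.coeff i g : unrIntegers p) : ℂ_[p])‖ = 1 := by
  haveI : IsNoetherian (IwasawaAlgebra p) X := isNoetherian_of_isNoetherianRing_of_finite _ _
  haveI : Module.Finite (IwasawaAlgebra p) (Submodule.torsion (IwasawaAlgebra p) X) :=
    Module.Finite.iff_fg.mpr (IsNoetherian.noetherian _)
  -- `𝔖/ℋ` is torsion (a quotient of the torsion module `𝔖/Λκ`)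
  have hle : Submodule.span (IwasawaAlgebra p) {κ} ≤ H.comap LinearMap.id := by
    rw [Submodule.comap_id, Submodule.span_singleton_le_iff_mem]; exact hκH
  have hSH : Module.IsTorsion (IwasawaAlgebra p) (S ⧸ H) :=
    Literature.NumberTheory.EllipticCurves.isTorsion_of_surjective (Submodule.mapQ _ _ LinearMap.id hle) (fun y => by
      induction y using Submodule.Quotient.induction_on with
      | H s => exact ⟨Submodule.Quotient.mk s, by rw [Submodule.mapQ_apply, LinearMap.id_apply]⟩) hS1
  have hμ1 := muInvariant_le_mul_of_charIdeal_dvd_pow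
    (Submodule.torsion_isTorsion (R := IwasawaAlgebra p) (M := X)) hSH 2 hHoward
  have hμ2 := muInvariant_quotient_le_of_mem H hκH hS1
  have hHoward' : muInvariant p (Submodule.torsion (IwasawaAlgebra p) X) ≤
      2 * muInvariant p (S ⧸ Submodule.span (IwasawaAlgebra p) {κ}) :=
    hμ1.trans (Nat.mul_le_mul_left 2 hμ2)
  exact isTorsion_and_exists_generator_twoSided hf₁ hg₁ h₁ hf₀ hg₀ h₀ hC hX₃ hdual κ hS1 loc eU eC
    hHoward' hβ

end Assembly

end Summit.BirchSwinnertonDyer.BirchSwinnertonDyer.Theorems.UniversalToricDescentTwoSidedMuTransfer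

end
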